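import Mathlib.Analysis.SpecialFunctions.SmoothTransition
import Mathlib.MeasureTheory.Integral.IntervalIntegral.FundThmCalculus
import Mathlib.Analysis.Calculus.ContDiff.Deriv
import Mathlib.Analysis.Calculus.Deriv.MeanValue
import Mathlib.Analysis.Calculus.InverseFunctionTheorem.ContDiff
import Mathlib.Analysis.Calculus.InverseFunctionTheorem.Deriv
import Mathlib.Topology.Order.MonotoneContinuity
import HarnessLib

/-!
# Smooth increasing reparametrisations of the line through prescribed knots

General real analysis (topic `Literature/Topology/FourManifolds`, infrastructure of brick E5a
of the constructive road (P1′) to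
`Literature.Topology.FourManifolds.Trisection.isConnectedSum_of_reducing_separating`,
`ReducibleTrisectionSplitting.lean`, § Status: relocating the plugs of the core ball inside
the ladder body by an `x`-reparametrisation of a bridge slab).  Given knots
`t 0 < t 1 < ⋯ < t N` and targets `s 0 < s 1 < ⋯ < s N` with `s 0 = t 0`, `s N = t N`, there is
a smooth `ψ : ℝ → ℝ` with `ψ' > 0`, `ψ (t j) = s j`, and `ψ = id` outside `[t 0, t N]`
(`exists_reparam`); it is a bijection with smooth inverse (`exists_reparam_inverse`).
Construction: `ψ x = t 0 + ∫_{t 0}^x w` with `w = 1 + Σ c_j β_j`, `β_j` a plateau bump inside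
`(t j, t (j+1))` and `c_j` chosen so that `∫_{t j}^{t (j+1)} w = s (j+1) - s j`.
Everything is **proved**; no named fact is introduced.

## References
* M. W. Hirsch, *Differential Topology* (1976), Ch. 2 §2 (smooth bump functions). [HirschDT1976]
-/

noncomputable section

open scoped Topology ContDiff
open Set Filter MeasureTheory intervalIntegral

namespace Literature.Topology.FourManifolds

namespace Reparam

/-! ### §1 Plateau bumps -/

/-- The plateau bump on `[α, β]` with margin `κ`: `0` off `(α + κ, β - κ)`, `1` on
`[α + 2κ, β - 2κ]`, smooth, with values in `[0, 1]`. [folklore] -/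
def plateau (α β κ x : ℝ) : ℝ :=
  Real.smoothTransition ((x - α - κ) / κ) * Real.smoothTransition ((β - κ - x) / κ)

/-- Elementary property of the construction. [folklore] -/
theorem contDiff_plateau (α β κ : ℝ) : ContDiff ℝ ∞ (plateau α β κ) :=
  (Real.smoothTransition.contDiff.comp ((contDiff_id.sub contDiff_const).sub contDiff_const |>.div_const κ)).mul
    (Real.smoothTransition.contDiff.comp ((contDiff_const.sub contDiff_id).div_const κ))

/-- Elementary property of the construction. [folklore] -/
theorem continuous_plateau (α β κ : ℝ) : Continuous (plateau α β κ) := (contDiff_plateau α β κ).continuous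

/-- Elementary property of the construction. [folklore] -/
theorem plateau_nonneg (α β κ x : ℝ) : 0 ≤ plateau α β κ x :=
  mul_nonneg (Real.smoothTransition.nonneg _) (Real.smoothTransition.nonneg _)

/-- Elementary property of the construction. [folklore] -/
theorem plateau_le_one (α β κ x : ℝ) : plateau α β κ x ≤ 1 :=
  mul_le_one₀ (Real.smoothTransition.le_one _) (Real.smoothTransition.nonneg _) (Real.smoothTransition.le_one _)

/-- Elementary property of the construction. [folklore] -/
theorem plateau_eq_zero_of_le {α β κ x : ℝ} (hκ : 0 < κ) (hx : x ≤ α + κ) : plateau α β κ x = 0 := by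
  unfold plateau
  rw [Real.smoothTransition.zero_of_nonpos (div_nonpos_of_nonpos_of_nonneg (by linarith) hκ.le), zero_mul]

/-- Elementary property of the construction. [folklore] -/
theorem plateau_eq_zero_of_ge {α β κ x : ℝ} (hκ : 0 < κ) (hx : β - κ ≤ x) : plateau α β κ x = 0 := by
  unfold plateau
  rw [Real.smoothTransition.zero_of_nonpos (x := (β - κ - x) / κ) (div_nonpos_of_nonpos_of_nonneg (by linarith) hκ.le), mul_zero]

/-- Elementary property of the construction. [folklore] -/
theorem plateau_eq_one {α β κ x : ℝ} (hκ : 0 < κ) (h1 : α + 2 * κ ≤ x) (h2 : x ≤ β - 2 * κ) : plateau α β κ x = 1 := by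
  unfold plateau
  rw [Real.smoothTransition.one_of_one_le ((one_le_div hκ).2 (by linarith)),
    Real.smoothTransition.one_of_one_le ((one_le_div hκ).2 (by linarith)), mul_one]

/-- The plateau bump vanishes off the open interval `(α, β)`. [folklore] -/
theorem plateau_eq_zero_of_not_mem {α β κ x : ℝ} (hκ : 0 < κ) (hx : x ∉ Ioo (α + κ) (β - κ)) : plateau α β κ x = 0 := by
  rw [mem_Ioo, not_and_or, not_lt, not_lt] at hx
  rcases hx with h | h
  · exact plateau_eq_zero_of_le hκ h
  · exact plateau_eq_zero_of_ge hκ h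

/-- **The integral of the plateau bump is at least the plateau length.** [folklore] -/
theorem le_integral_plateau {α β κ : ℝ} (hκ : 0 < κ) (h : α + 2 * κ ≤ β - 2 * κ) :
    (β - 2 * κ) - (α + 2 * κ) ≤ ∫ x in α..β, plateau α β κ x := by
  have hint : ∀ a b, IntervalIntegrable (plateau α β κ) volume a b := fun a b =>
    (continuous_plateau α β κ).intervalIntegrable a b
  have hαβ : α ≤ β := by linarith
  -- split `[α, β] = [α, α+2κ] ∪ [α+2κ, β-2κ] ∪ [β-2κ, β]`
  rw [← integral_add_adjacent_intervals (hint α (α + 2 * κ)) (hint (α + 2 * κ) β),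
    ← integral_add_adjacent_intervals (hint (α + 2 * κ) (β - 2 * κ)) (hint (β - 2 * κ) β)]
  have h1 : 0 ≤ ∫ x in α..(α + 2 * κ), plateau α β κ x :=
    integral_nonneg (by linarith) fun x _ => plateau_nonneg _ _ _ x
  have h3 : 0 ≤ ∫ x in (β - 2 * κ)..β, plateau α β κ x :=
    integral_nonneg (by linarith) fun x _ => plateau_nonneg _ _ _ x
  have h2 : ∫ x in (α + 2 * κ)..(β - 2 * κ), plateau α β κ x = (β - 2 * κ) - (α + 2 * κ) := by
    rw [integral_congr (g := fun _ => (1 : ℝ)) fun x hx => ?_, intervalIntegral.integral_const, smul_eq_mul, mul_one]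
    rw [uIcc_of_le h] at hx
    exact plateau_eq_one hκ hx.1 hx.2
  linarith

/-! ### §2 The reparametrisation -/

section Construction

variable {N : ℕ} (t s : ℕ → ℝ)

/-- The margin of the `j`-th interval. [folklore] -/
def margin (j : ℕ) : ℝ := min (t (j + 1) - t j) (s (j + 1) - s j) / 5

/-- The `j`-th plateau bump. [folklore] -/
def bumpJ (j : ℕ) (x : ℝ) : ℝ := plateau (t j) (t (j + 1)) (margin t s j) x

/-- The integral of the `j`-th plateau bump over its interval. [folklore] -/
def massJ (j : ℕ) : ℝ := ∫ x in (t j)..(t (j + 1)), bumpJ t s j x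

/-- The coefficient of the `j`-th bump. [folklore] -/
def coefJ (j : ℕ) : ℝ := ((s (j + 1) - s j) - (t (j + 1) - t j)) / massJ t s j

/-- The density `w = 1 + Σ_{j < N} c_j β_j`. [folklore] -/
def dens (N : ℕ) (x : ℝ) : ℝ := 1 + ∑ j ∈ Finset.range N, coefJ t s j * bumpJ t s j x

/-- **The reparametrisation** `ψ x = t 0 + ∫_{t 0}^x w`. [folklore] -/
def psi (N : ℕ) (x : ℝ) : ℝ := t 0 + ∫ y in (t 0)..x, dens t s N y

variable {t s} (ht : ∀ j < N, t j < t (j + 1)) (hs : ∀ j < N, s j < s (j + 1))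

include ht hs in
/-- Elementary property of the construction. [folklore] -/
theorem margin_pos {j : ℕ} (hj : j < N) : 0 < margin t s j := by
  unfold margin
  have := ht j hj; have := hs j hj
  exact div_pos (lt_min (by linarith) (by linarith)) (by norm_num)

/-- Elementary property of the construction. [folklore] -/
theorem margin_le (j : ℕ) :
    5 * margin t s j ≤ t (j + 1) - t j ∧ 5 * margin t s j ≤ s (j + 1) - s j := by
  unfold margin
  constructor
  · linarith [min_le_left (t (j + 1) - t j) (s (j + 1) - s j)]
  · linarith [min_le_right (t (j + 1) - t j) (s (j + 1) - s j)]

/-- Elementary property of the construction. [folklore] -/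
theorem contDiff_bumpJ (j : ℕ) : ContDiff ℝ ∞ (bumpJ t s j) := contDiff_plateau _ _ _

/-- Elementary property of the construction. [folklore] -/
theorem continuous_bumpJ (j : ℕ) : Continuous (bumpJ t s j) := (contDiff_bumpJ j).continuous

include ht hs in
/-- The mass is larger than `ℓ_j - 4κ_j`. [folklore] -/
theorem massJ_ge {j : ℕ} (hj : j < N) : (t (j + 1) - t j) - 4 * margin t s j ≤ massJ t s j := by
  have hκ := margin_pos ht hs hj
  have hm := margin_le (t := t) (s := s) j
  have := le_integral_plateau (α := t j) (β := t (j + 1)) hκ (by linarith [hm.1])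
  unfold massJ bumpJ
  linarith

include ht hs in
/-- Elementary property of the construction. [folklore] -/
theorem massJ_pos {j : ℕ} (hj : j < N) : 0 < massJ t s j := by
  have := massJ_ge ht hs hj; have := margin_le (t := t) (s := s) j; have := margin_pos ht hs hj
  linarith [this]

include ht hs in
/-- `1 + c_j > 0`. [folklore] -/
theorem one_add_coefJ_pos {j : ℕ} (hj : j < N) : 0 < 1 + coefJ t s j := by
  have hm := massJ_pos ht hs hj
  have hge := massJ_ge ht hs hj
  have hκ := margin_le (t := t) (s := s) j
  have hκ0 := margin_pos ht hs hj
  unfold coefJ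
  rw [show 1 + ((s (j + 1) - s j) - (t (j + 1) - t j)) / massJ t s j =
      (massJ t s j + ((s (j + 1) - s j) - (t (j + 1) - t j))) / massJ t s j by field_simp]
  exact div_pos (by linarith) hm

include ht hs in
/-- The bumps have disjoint supports: if `β_j x ≠ 0` then `x ∈ (t j, t (j+1))`. [folklore] -/
theorem mem_of_bumpJ_ne_zero {j : ℕ} (hj : j < N) {x : ℝ} (hx : bumpJ t s j x ≠ 0) :
    x ∈ Ioo (t j + margin t s j) (t (j + 1) - margin t s j) := by
  by_contra h
  exact hx (plateau_eq_zero_of_not_mem (margin_pos ht hs hj) h)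

/-- Knots are monotone: `t i ≤ t j` for `i ≤ j ≤ N`. [folklore] -/
theorem monotone_knots {t : ℕ → ℝ} (ht : ∀ j < N, t j < t (j + 1)) {i j : ℕ} (hij : i ≤ j) (hj : j ≤ N) :
    t i ≤ t j := by
  induction j with
  | zero => simp at hij; rw [hij]
  | succ j ih =>
    rcases Nat.lt_or_ge i (j + 1) with h | h
    · exact (ih (Nat.lt_succ_iff.1 h) (Nat.le_of_succ_le hj)).trans (ht j hj).le
    · rw [le_antisymm hij h]

include ht hs in
/-- At most one bump is on at any point: `Σ_j |c_j| β_j x ≤ max_j`-type bound, in the form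
`w x ≥ min (1, min_j (1 + c_j))`; concretely `w x > 0`. [folklore] -/
theorem dens_pos (x : ℝ) : 0 < dens t s N x := by
  unfold dens
  by_cases hx : ∃ j < N, bumpJ t s j x ≠ 0
  · obtain ⟨j, hj, hjx⟩ := hx
    have hmem := mem_of_bumpJ_ne_zero ht hs hj hjx
    -- all other bumps vanish at `x`
    have hzero : ∀ i ∈ Finset.range N, i ≠ j → coefJ t s i * bumpJ t s i x = 0 := by
      intro i hi hij
      have hi' := Finset.mem_range.1 hi
      rw [mul_eq_zero]; right
      by_contra hne
      have hmem' := mem_of_bumpJ_ne_zero ht hs hi' hne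
      have hκi := margin_pos ht hs hi'
      have hκj := margin_pos ht hs hj
      rcases lt_or_gt_of_ne hij with h | h
      · have : t (i + 1) ≤ t j := monotone_knots ht h hj.le
        linarith [hmem.1, hmem'.2]
      · have : t (j + 1) ≤ t i := monotone_knots ht h hi'.le
        linarith [hmem'.1, hmem.2]
    rw [Finset.sum_eq_single_of_mem j (Finset.mem_range.2 hj) hzero]
    have h1 := one_add_coefJ_pos ht hs hj
    have hb0 := plateau_nonneg (t j) (t (j + 1)) (margin t s j) x
    have hb1 := plateau_le_one (t j) (t (j + 1)) (margin t s j) x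
    unfold bumpJ
    rcases le_or_gt 0 (coefJ t s j) with hc | hc
    · nlinarith
    · nlinarith
  · push Not at hx
    rw [Finset.sum_eq_zero fun i hi => by rw [hx i (Finset.mem_range.1 hi), mul_zero]]
    norm_num

/-- Elementary property of the construction. [folklore] -/
theorem contDiff_dens : ContDiff ℝ ∞ (dens t s N) := by
  unfold dens
  exact contDiff_const.add (ContDiff.sum fun j _ => contDiff_const.mul (contDiff_bumpJ j))

/-- Elementary property of the construction. [folklore] -/
theorem continuous_dens : Continuous (dens t s N) := contDiff_dens.continuous

/-- **Fundamental theorem of calculus for `ψ`**: `ψ' = w`. [folklore] -/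
theorem hasDerivAt_psi (x : ℝ) : HasDerivAt (psi t s N) (dens t s N x) x := by
  unfold psi
  exact (integral_hasDerivAt_right ((continuous_dens).intervalIntegrable _ _)
    continuous_dens.aestronglyMeasurable.stronglyMeasurableAtFilter continuous_dens.continuousAt).const_add _

/-- Elementary property of the construction. [folklore] -/
theorem deriv_psi (x : ℝ) : deriv (psi t s N) x = dens t s N x := (hasDerivAt_psi x).deriv

/-- **`ψ` is smooth.** [folklore] -/
theorem contDiff_psi : ContDiff ℝ ∞ (psi t s N) := by
  rw [contDiff_infty_iff_deriv]
  refine ⟨fun x => (hasDerivAt_psi x).differentiableAt, ?_⟩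
  rw [show deriv (psi t s N) = dens t s N from funext deriv_psi]
  exact contDiff_dens

include ht hs in
/-- **`ψ` is strictly increasing.** [folklore] -/
theorem strictMono_psi : StrictMono (psi t s N) :=
  strictMono_of_deriv_pos fun x => by rw [deriv_psi]; exact dens_pos ht hs x

include ht hs in
/-- Off the union of the open intervals, the density is `1`. [folklore] -/
theorem dens_eq_one {x : ℝ} (hx : x ≤ t 0 ∨ t N ≤ x) : dens t s N x = 1 := by
  unfold dens
  rw [Finset.sum_eq_zero fun j hj => ?_, add_zero]
  have hj' := Finset.mem_range.1 hj
  rw [mul_eq_zero]; right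
  by_contra hne
  have hmem := mem_of_bumpJ_ne_zero ht hs hj' hne
  have hκ := margin_pos ht hs hj'
  rcases hx with h | h
  · have : t 0 ≤ t j := monotone_knots ht (Nat.zero_le j) hj'.le
    linarith [hmem.1]
  · have : t (j + 1) ≤ t N := monotone_knots ht hj' le_rfl
    linarith [hmem.2]

include ht hs in
/-- **`ψ = id` below the first knot.** [folklore] -/
theorem psi_of_le {x : ℝ} (hx : x ≤ t 0) : psi t s N x = x := by
  unfold psi
  rw [integral_congr (g := fun _ => (1 : ℝ)) fun y hy => ?_, intervalIntegral.integral_const, smul_eq_mul, mul_one]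
  · ring
  · rw [uIcc_of_ge hx] at hy
    exact dens_eq_one ht hs (Or.inl hy.2)

include ht hs in
/-- The integral of `w` over the `j`-th interval is `s (j+1) - s j`. [folklore] -/
theorem integral_dens_interval {j : ℕ} (hj : j < N) :
    ∫ y in (t j)..(t (j + 1)), dens t s N y = s (j + 1) - s j := by
  have hκ := margin_pos ht hs hj
  have htj := ht j hj
  unfold dens
  have hg : Continuous fun y => ∑ i ∈ Finset.range N, coefJ t s i * bumpJ t s i y :=
    continuous_finsetSum _ fun i _ => continuous_const.mul (continuous_bumpJ i)
  have hadd := intervalIntegral.integral_add (a := t j) (b := t (j + 1)) (f := fun _ => (1 : ℝ))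
    (g := fun y => ∑ i ∈ Finset.range N, coefJ t s i * bumpJ t s i y) (μ := volume)
    intervalIntegrable_const (hg.intervalIntegrable _ _)
  rw [hadd, intervalIntegral.integral_const, smul_eq_mul, mul_one]
  have hsum := intervalIntegral.integral_finsetSum (a := t j) (b := t (j + 1)) (μ := volume)
    (s := Finset.range N) (f := fun i y => coefJ t s i * bumpJ t s i y)
    fun i _ => (continuous_const.mul (continuous_bumpJ i)).intervalIntegrable _ _
  rw [hsum]
  -- only the `j`-th bump contributes
  rw [Finset.sum_eq_single_of_mem j (Finset.mem_range.2 hj) fun i hi hij => ?_]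
  · rw [intervalIntegral.integral_const_mul]
    unfold coefJ
    rw [show (∫ x in t j..t (j + 1), bumpJ t s j x) = massJ t s j from rfl,
      div_mul_cancel₀ _ (massJ_pos ht hs hj).ne']
    ring
  · have hi' := Finset.mem_range.1 hi
    rw [intervalIntegral.integral_const_mul, mul_eq_zero]; right
    rw [integral_congr (g := fun _ => (0 : ℝ)) fun y hy => ?_, intervalIntegral.integral_zero]
    rw [uIcc_of_le htj.le] at hy
    by_contra hne
    have hmem := mem_of_bumpJ_ne_zero ht hs hi' hne
    have hκi := margin_pos ht hs hi'
    rcases lt_or_gt_of_ne hij with h | h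
    · have : t (i + 1) ≤ t j := monotone_knots ht h hj.le
      linarith [hmem.2, hy.1]
    · have : t (j + 1) ≤ t i := monotone_knots ht h hi'.le
      linarith [hmem.1, hy.2]

include ht hs in
/-- **`ψ` interpolates the knots**: `ψ (t j) = s j` for `j ≤ N` (given `s 0 = t 0`). [folklore] -/
theorem psi_knot (h0 : s 0 = t 0) {j : ℕ} (hj : j ≤ N) : psi t s N (t j) = s j := by
  induction j with
  | zero => rw [psi_of_le ht hs le_rfl, h0]
  | succ j ih =>
    have hj' : j < N := hj
    have h1 := ih hj'.le
    unfold psi at h1 ⊢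
    have hint : ∀ a b, IntervalIntegrable (dens t s N) volume a b := fun a b =>
      continuous_dens.intervalIntegrable a b
    rw [← integral_add_adjacent_intervals (hint (t 0) (t j)) (hint (t j) (t (j + 1))),
      integral_dens_interval ht hs hj']
    linarith

include ht hs in
/-- **`ψ = id` above the last knot** (given `s 0 = t 0`, `s N = t N`). [folklore] -/
theorem psi_of_ge (h0 : s 0 = t 0) (hN : s N = t N) {x : ℝ} (hx : t N ≤ x) : psi t s N x = x := by
  have h1 := psi_knot ht hs h0 le_rfl (j := N)
  unfold psi at h1 ⊢
  have hint : ∀ a b, IntervalIntegrable (dens t s N) volume a b := fun a b =>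
    continuous_dens.intervalIntegrable a b
  rw [← integral_add_adjacent_intervals (hint (t 0) (t N)) (hint (t N) x)]
  rw [integral_congr (g := fun _ => (1 : ℝ)) (a := t N) fun y hy => ?_, intervalIntegral.integral_const, smul_eq_mul, mul_one]
  · linarith
  · rw [uIcc_of_le hx] at hy
    exact dens_eq_one ht hs (Or.inr hy.1)

include ht hs in
/-- **`ψ` is surjective** (it is the identity near `±∞`). [folklore] -/
theorem surjective_psi (h0 : s 0 = t 0) (hN : s N = t N) : Function.Surjective (psi t s N) := by
  intro y
  rcases le_or_gt y (t 0) with hy | hy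
  · exact ⟨y, psi_of_le ht hs hy⟩
  rcases le_or_gt (t N) y with hy' | hy'
  · exact ⟨y, psi_of_ge ht hs h0 hN hy'⟩
  · -- intermediate value on `[t 0, t N]`
    have hcont : ContinuousOn (psi t s N) (Icc (t 0) (t N)) := contDiff_psi.continuous.continuousOn
    have h0N : t 0 ≤ t N := monotone_knots ht (Nat.zero_le N) le_rfl
    have := intermediate_value_Icc h0N hcont
    rw [psi_of_le ht hs le_rfl, psi_of_ge ht hs h0 hN le_rfl] at this
    obtain ⟨x, -, hx⟩ := this ⟨hy.le, hy'.le⟩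
    exact ⟨x, hx⟩

end Construction

/-! ### §3 The statements -/

/-- **Smooth increasing reparametrisation through prescribed knots.**  For knots
`t 0 < ⋯ < t N` and targets `s 0 < ⋯ < s N` with `s 0 = t 0` and `s N = t N` there is a smooth
bijection `ψ : ℝ → ℝ` with `ψ' > 0`, `ψ (t j) = s j` for all `j ≤ N`, and `ψ x = x` for
`x ≤ t 0` and for `t N ≤ x`. [folklore] -/
theorem exists_reparam {N : ℕ} {t s : ℕ → ℝ} (ht : ∀ j < N, t j < t (j + 1)) (hs : ∀ j < N, s j < s (j + 1))
    (h0 : s 0 = t 0) (hN : s N = t N) :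
    ∃ ψ : ℝ → ℝ, ContDiff ℝ ∞ ψ ∧ (∀ x, 0 < deriv ψ x) ∧ StrictMono ψ ∧ Function.Surjective ψ ∧
      (∀ j ≤ N, ψ (t j) = s j) ∧ (∀ x ≤ t 0, ψ x = x) ∧ (∀ x, t N ≤ x → ψ x = x) :=
  ⟨psi t s N, contDiff_psi, fun x => by rw [deriv_psi]; exact dens_pos ht hs x, strictMono_psi ht hs,
    surjective_psi ht hs h0 hN, fun _ hj => psi_knot ht hs h0 hj, fun _ hx => psi_of_le ht hs hx,
    fun _ hx => psi_of_ge ht hs h0 hN hx⟩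

/-- **A smooth bijection of `ℝ` with positive derivative has a smooth inverse.** [folklore] -/
theorem exists_smooth_inverse {ψ : ℝ → ℝ} (hψ : ContDiff ℝ ∞ ψ) (hder : ∀ x, 0 < deriv ψ x)
    (hmono : StrictMono ψ) (hsurj : Function.Surjective ψ) :
    ∃ φ : ℝ → ℝ, ContDiff ℝ ∞ φ ∧ (∀ x, φ (ψ x) = x) ∧ (∀ y, ψ (φ y) = y) ∧ StrictMono φ := by
  set e : ℝ ≃o ℝ := hmono.orderIsoOfSurjective ψ hsurj with he
  have heψ : ∀ x, e x = ψ x := fun x => rfl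
  refine ⟨e.symm, ?_, fun x => e.symm_apply_apply x, fun y => by rw [← heψ, e.apply_symm_apply], e.symm.strictMono⟩
  -- smoothness of the inverse, pointwise by the inverse function theorem
  rw [contDiff_iff_contDiffAt]
  intro y
  set H : OpenPartialHomeomorph ℝ ℝ := e.toHomeomorph.toOpenPartialHomeomorph with hH
  have hy : y ∈ H.target := by simp [hH]
  have hd : HasDerivAt ψ (deriv ψ (e.symm y)) (e.symm y) :=
    (hψ.differentiable (by simp) _).hasDerivAt
  have hfd := hd.hasFDerivAt_equiv (hder _).ne'
  have key := H.contDiffAt_symm hy (f₀' := ContinuousLinearEquiv.unitsEquivAut ℝ (Units.mk0 _ (hder (e.symm y)).ne'))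
    (by
      have : H.symm y = e.symm y := rfl
      rw [this]; exact hfd)
    (by
      have : H.symm y = e.symm y := rfl
      rw [this]; exact hψ.contDiffAt)
  exact key

end Reparam

end Literature.Topology.FourManifolds
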